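/-
Copyright (c) 2026 the pub-hodgecm-mathlib formalisation cell (harness21).  Prover seat hodgecm-mathlib-LH7-p10 (g0), req620 Track A «(D-RAM) FOUR-FRAME» squad
(STAGE-1b, row (2) of the piece `f_{T₊}`, the (β₂) road (R-36); β₂ sub-dealer LH4-p04 (g8) ruling (R-q) «the HYP boundary cell B is a NAMED cell whose `cellDiff` VANISHES at
q = 2 by size; (L-Σ) ED. 1 under `#𝓀 = 2`»; sequel of ★ p861408 ∕ ★ p861491), 2026-09-04.
-/
import Summits.HodgeConjecture.HodgeConjecture.Theorems.F0P3cDyRamConeCellLedgerSizes       -- ★ p861408 (this seat): RamK row readers (`ncard_levelSet_boundary_ramK_hyper`), low-cell depth reduction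
import Summits.HodgeConjecture.HodgeConjecture.Theorems.F0P3cDyRamConeCellLedgerSizesRamM   -- ★ p861491 (this seat): RamM row readers (`ncard_levelSet_boundary_ramM_hyper`)
import Summits.HodgeConjecture.HodgeConjecture.Theorems.F0P3cDyRamToricLevelSetFinite       -- ★ p857791 (LH4-p08 (g5)): `levelSet_finite'`
import HarnessLib

/-!
# Crux `H413`, line LH4 «(D-RAM) FOUR-FRAME» — STAGE-1b, row (2), the (β₂) road (R-36): «THE HYPERBOLIC BOUNDARY CELL `B` IS EMPTY WHEN `q = 2`, SO ITS `cellDiff` VANISHES THERE»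
# (RamK lane: `B = (a + 2d − 2, a)` with `(q−2)q^{j−d}` lattices; RamM lane: `j + 2 = a + s0 + 2g` with `(q−2)q^{j−1−k∕2}`; at `#𝓀[E] = 2` both are `∅`, hence any
#  `Σᶠ_{B ∩ q₊} f − Σᶠ_{B ∩ q₋} f = 0`, u-free — the (L-Σ) ED. 1 term the sub-dealer carries symbolically, evaluated)

Cell `hodgecm-mathlib` (D-0151), FLOOR 0, crux item H413 = `stmt-HodgeConjecture-24833`, route of record `HCCMUnconditional`; squad F0∕P3c∕LH4; lane
`--supports stmt-HodgeConjecture-24833 --as helper` (count-neutral; pays NO tier-0 row).  THEOREMS ONLY (no `def`, no instance, no notation, no `sorry`, default heartbeats);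
★-only imports; states NO law; (β₂) stays a HYPOTHESIS.

WHY (β₂ sub-dealer LH4-p04 (g8) 15:37:31Z (R-q); heir LEAD T20-22).  The pure-cell ledger of the (β₂) letter is typed q-GENERALLY; at the HYPERBOLIC literal the boundary row
(`c + 2 = 2d` in the RamK lane, `k + 2 = 2g` in the RamM lane) is a NAMED cell `B` with `(q − 2)·q^{…}` plane lattices (★ p861408 `ncard_levelSet_boundary_ramK_hyper`, ★ p861491
`ncard_levelSet_boundary_ramM_hyper`) whose labels are UNWITNESSED for `q ≥ 4` (every engine key has `q = 2`).  (L-Σ) therefore carries `cellDiff_HYP(B)` symbolically and lands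
ED. 1 under the explicit hypothesis `#𝓀 = 2`.  THIS FILE evaluates that term: at `q = 2` the cell is EMPTY (its u-free level set is finite of cardinality `0`), so `levelSetDep(B; μ) = ∅`
for EVERY multiplier `μ` (no tokens needed: `levelSetDep ⊆ levelSet`), and every labelled weighted difference over it is `0`.
* §0 (datum-free) `finsum_inter_sub_finsum_inter_eq_zero_of_eq_empty` (`S = ∅` ⇒ `Σᶠ_{S ∩ P} f − Σᶠ_{S ∩ Q} f = 0`) and `levelSetDep_eq_empty_of_levelSet_eq_empty`.
* §1 RamK lane at `#𝓀[K] = 2²`: `levelSet_boundary_ramK_hyper_eq_empty_of_card` (`j + 2 = a + 2d`, `a ≥ 1`, `d ≥ 2`, `h` isotropic) and its `levelSetDep` ∕ `cellDiff = 0` forms.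
* §2 RamM lane at `#𝓀[K] = 2`: `levelSet_boundary_ramM_hyper_eq_empty_of_card` (`j + 2 = a + s0 + 2g`, `a ≥ 1`, `g ≥ 1`, `h` isotropic) and its `levelSetDep` ∕ `cellDiff = 0` forms.
NOT CLAIMED: anything at `q ≥ 4` (there `B` is populated: `(q−2)q^{…} ≠ 0`), anything about the ANISOTROPIC boundary cell (populated at every q: `q^{j−d+1}` ∕ `q^{j−k∕2}`), labels.
HONEST LABEL.  Count-neutral index bookkeeping over ★ tables; nothing printed is asserted; no census law is stated; (β₂) the LETTER UNPROVED; `HC_CM` is proved only modulo the 7 printed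
citations (2 remaining named inputs: hLiu418 = `stmt-HodgeConjecture-24832`, h413 = `stmt-HodgeConjecture-24833`) until rung 0 closes.
## References
* [Flicker1998UnitaryFL] Y. Z. Flicker, *Elementary proof of the fundamental lemma for a unitary group*, Canad. J. Math. 50 (1998), Prop. 7 p. 84 (torus-orbit census on the tree).
* [Kottwitz1986BaseChangeUnits] R. E. Kottwitz, *Base change for unit elements of Hecke algebras*, Compositio Math. 60 (1986), §1 pp. 240–241.
* [Serre1979] J.-P. Serre, *Local Fields*, GTM 67 (1979), Ch. V §3 Prop. 5, Cor. 2–3 pp. 84–86.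
-/

set_option autoImplicit false

noncomputable section

open scoped Valued Classical
open WithZero IsLocalRing
open Literature.NumberTheory.Automorphic.UnitaryThreeFourFrame (IsRamifiedQuadraticDatum)
open Summit.HodgeConjecture.HodgeConjecture.Cruxes.H413.F0P3cDyRamToricCensusDefs
open Summit.HodgeConjecture.HodgeConjecture.Cruxes.H413.F0P3cDyRamToricLevelSetFinite (levelSet_finite')
open Summit.HodgeConjecture.HodgeConjecture.Cruxes.H413.F0P3cDyRamConeCellLedgerSizes (ncard_levelSet_boundary_ramK_hyper)
open Summit.HodgeConjecture.HodgeConjecture.Cruxes.H413.F0P3cDyRamConeCellLedgerSizesRamM (ncard_levelSet_boundary_ramM_hyper)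

namespace Summit.HodgeConjecture.HodgeConjecture.Cruxes.H413.F0P3cDyRamConeCellBoundaryEmptyAtTwo

/-! ## §0 Datum-free bookkeeping -/

/-- **AN EMPTY CELL CONTRIBUTES NOTHING**: `S = ∅` ⇒ `(Σᶠ_{S ∩ P} f : ℤ) − Σᶠ_{S ∩ Q} f = 0` for any labels `P, Q` and weight `f`. [cite: Kottwitz1986BaseChangeUnits, §1 pp. 240–241] -/
theorem finsum_inter_sub_finsum_inter_eq_zero_of_eq_empty {ι : Type*} (S : Set ι) (hS : S = ∅) (P Q : ι → Prop) (f : ι → ℕ) :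
    ((∑ᶠ x ∈ S ∩ {x | P x}, f x : ℕ) : ℤ) - ((∑ᶠ x ∈ S ∩ {x | Q x}, f x : ℕ) : ℤ) = 0 := by
  subst hS
  rw [Set.empty_inter, Set.empty_inter, finsum_mem_empty, Nat.cast_zero, sub_zero]

section Generic

variable {K : Type*} [Field K] [Valued K ℤᵐ⁰] {ρ Θ : K →+* K} {α ϖE h : K}

/-- `levelSetDep(j, a; μ) = ∅` as soon as the u-free `levelSet(j, a) = ∅` (★ DEFS `levelSetDep_subset`; no token needed). [cite: Kottwitz1986BaseChangeUnits, §1 pp. 240–241] -/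
theorem levelSetDep_eq_empty_of_levelSet_eq_empty {j a : ℕ} (hL : levelSet ρ Θ α ϖE h j a = ∅) (μ : K) :
    levelSetDep ρ Θ α ϖE h j a μ = ∅ :=
  Set.subset_eq_empty (levelSetDep_subset ρ Θ α ϖE h j a μ) hL

/-- A finite level set of cardinality `0` is empty (★ `levelSet_finite'` + `Set.ncard_eq_zero`). [cite: Flicker1998UnitaryFL, Prop. 7 p. 84] -/
theorem levelSet_eq_empty_of_ncard_eq_zero [IsDiscreteValuationRing 𝒪[K]] [Finite 𝓀[K]]
    (hvρ : ∀ x, Valued.v (ρ x) = Valued.v x) (hvΘ : ∀ x, Valued.v (Θ x) = Valued.v x) {j a : ℕ}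
    (h0 : (levelSet ρ Θ α ϖE h j a).ncard = 0) : levelSet ρ Θ α ϖE h j a = ∅ :=
  (Set.ncard_eq_zero (levelSet_finite' hvρ hvΘ ϖE h j a)).1 h0

end Generic

/-! ## §1 RamK lane: the hyperbolic boundary cell is empty at `q = 2` -/

section RamK

variable {K : Type} [Field K] [Valued K ℤᵐ⁰] {ρ Θ : K →+* K} {α ϖE h : K}

/-- **RamK, `q = 2`: THE HYPERBOLIC BOUNDARY CELL `j + 2 = a + 2d` IS EMPTY.**  Frame of ★ p861408 `ncard_levelSet_boundary_ramK_hyper` at `#𝓀[K] = 2²` (`a ≥ 1`, `d ≥ 2`, `h` Θ-fixed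
non-zero ISOTROPIC): `levelSet(j, a) = ∅` — its count is `(2 − 2)·2^{j−d} = 0` and the set is finite. [cite: Flicker1998UnitaryFL, Prop. 7 p. 84] [cite: Serre1979, Ch. V §3 Prop. 5, Cor. 2–3 pp. 84–86] -/
theorem levelSet_boundary_ramK_hyper_eq_empty_of_card [CompleteSpace K] [IsDiscreteValuationRing 𝒪[K]] [Finite 𝓀[K]]
    (hρρ : ∀ x, ρ (ρ x) = x) (hvρ : ∀ x, Valued.v (ρ x) = Valued.v x) (hΘρ : ∀ x, Θ (ρ x) = ρ (Θ x))
    (hα1 : Valued.v α ≤ 1) (hα : Valued.v (α - ρ α) = 1) {d t : ℕ} (hD : IsRamifiedQuadraticDatum Θ ϖE d t) (hρϖ : ρ ϖE = ϖE)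
    (hΘh : Θ h = h) (hh : h ≠ 0) (hq : Nat.card 𝓀[K] = 2 ^ 2)
    (hσres : ∀ z : K, ρ z = z → Valued.v z ≤ 1 → Valued.v (Θ z - z) < 1) (hram : Valued.v (α - Θ α) < 1)
    (hhyper : ∃ x : K, x ≠ 0 ∧ h * Θ x * x + ρ (h * Θ x * x) = 0)
    (hd2 : 2 ≤ d) {j a : ℕ} (ha : 1 ≤ a) (hbdry : j + 2 = a + 2 * d) :
    levelSet ρ Θ α ϖE h j a = ∅ := by
  refine levelSet_eq_empty_of_ncard_eq_zero hvρ hD.2.1 ?_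
  rw [ncard_levelSet_boundary_ramK_hyper hρρ hvρ hΘρ hα1 hα hD hρϖ hΘh hh hq hσres hram hhyper hd2 ha hbdry]
  norm_num

/-- **RamK, `q = 2`: `levelSetDep(B; μ) = ∅` FOR EVERY MULTIPLIER `μ`** (no token letters needed). [cite: Flicker1998UnitaryFL, Prop. 7 p. 84] [cite: Kottwitz1986BaseChangeUnits, §1 pp. 240–241] -/
theorem levelSetDep_boundary_ramK_hyper_eq_empty_of_card [CompleteSpace K] [IsDiscreteValuationRing 𝒪[K]] [Finite 𝓀[K]]
    (hρρ : ∀ x, ρ (ρ x) = x) (hvρ : ∀ x, Valued.v (ρ x) = Valued.v x) (hΘρ : ∀ x, Θ (ρ x) = ρ (Θ x))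
    (hα1 : Valued.v α ≤ 1) (hα : Valued.v (α - ρ α) = 1) {d t : ℕ} (hD : IsRamifiedQuadraticDatum Θ ϖE d t) (hρϖ : ρ ϖE = ϖE)
    (hΘh : Θ h = h) (hh : h ≠ 0) (hq : Nat.card 𝓀[K] = 2 ^ 2)
    (hσres : ∀ z : K, ρ z = z → Valued.v z ≤ 1 → Valued.v (Θ z - z) < 1) (hram : Valued.v (α - Θ α) < 1)
    (hhyper : ∃ x : K, x ≠ 0 ∧ h * Θ x * x + ρ (h * Θ x * x) = 0)
    (hd2 : 2 ≤ d) {j a : ℕ} (ha : 1 ≤ a) (hbdry : j + 2 = a + 2 * d) (μ : K) :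
    levelSetDep ρ Θ α ϖE h j a μ = ∅ :=
  levelSetDep_eq_empty_of_levelSet_eq_empty
    (levelSet_boundary_ramK_hyper_eq_empty_of_card hρρ hvρ hΘρ hα1 hα hD hρϖ hΘh hh hq hσres hram hhyper hd2 ha hbdry) μ

/-- **RamK, `q = 2`: THE `cellDiff` OF THE HYPERBOLIC BOUNDARY CELL VANISHES** — for every multiplier `μ`, labels `P, Q` and weight `f`:
`(Σᶠ_{levelSetDep(B; μ) ∩ P} f : ℤ) − Σᶠ_{levelSetDep(B; μ) ∩ Q} f = 0` (the (L-Σ) ED. 1 term, evaluated). [cite: Kottwitz1986BaseChangeUnits, §1 pp. 240–241] [cite: Flicker1998UnitaryFL, Prop. 7 p. 84] -/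
theorem cellDiff_boundary_ramK_hyper_eq_zero_of_card [CompleteSpace K] [IsDiscreteValuationRing 𝒪[K]] [Finite 𝓀[K]]
    (hρρ : ∀ x, ρ (ρ x) = x) (hvρ : ∀ x, Valued.v (ρ x) = Valued.v x) (hΘρ : ∀ x, Θ (ρ x) = ρ (Θ x))
    (hα1 : Valued.v α ≤ 1) (hα : Valued.v (α - ρ α) = 1) {d t : ℕ} (hD : IsRamifiedQuadraticDatum Θ ϖE d t) (hρϖ : ρ ϖE = ϖE)
    (hΘh : Θ h = h) (hh : h ≠ 0) (hq : Nat.card 𝓀[K] = 2 ^ 2)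
    (hσres : ∀ z : K, ρ z = z → Valued.v z ≤ 1 → Valued.v (Θ z - z) < 1) (hram : Valued.v (α - Θ α) < 1)
    (hhyper : ∃ x : K, x ≠ 0 ∧ h * Θ x * x + ρ (h * Θ x * x) = 0)
    (hd2 : 2 ≤ d) {j a : ℕ} (ha : 1 ≤ a) (hbdry : j + 2 = a + 2 * d) (μ : K)
    (P Q : AddSubgroup K → Prop) (f : AddSubgroup K → ℕ) :
    ((∑ᶠ Λ ∈ levelSetDep ρ Θ α ϖE h j a μ ∩ {Λ | P Λ}, f Λ : ℕ) : ℤ) - ((∑ᶠ Λ ∈ levelSetDep ρ Θ α ϖE h j a μ ∩ {Λ | Q Λ}, f Λ : ℕ) : ℤ) = 0 :=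
  finsum_inter_sub_finsum_inter_eq_zero_of_eq_empty _
    (levelSetDep_boundary_ramK_hyper_eq_empty_of_card hρρ hvρ hΘρ hα1 hα hD hρϖ hΘh hh hq hσres hram hhyper hd2 ha hbdry μ) P Q f

end RamK

/-! ## §2 RamM lane: the hyperbolic boundary cell is empty at `q = 2` -/

section RamM

variable {K : Type} [Field K] [Valued K ℤᵐ⁰] {ρ Θ : K →+* K}

/-- **RamM, `q = 2`: THE HYPERBOLIC BOUNDARY CELL `j + 2 = a + s0 + 2g` IS EMPTY.**  Frame of ★ p861491 `ncard_levelSet_boundary_ramM_hyper` at `#𝓀[K] = 2` (`a ≥ 1`, `g ≥ 1`, `h` Θ-fixed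
non-zero ISOTROPIC): `levelSet(j, a) = ∅` — count `(2 − 2)·2^{…} = 0`, finite set. [cite: Flicker1998UnitaryFL, Prop. 7 p. 84] [cite: Serre1979, Ch. V §3 Prop. 5, Cor. 2–3 pp. 84–86] -/
theorem levelSet_boundary_ramM_hyper_eq_empty_of_card [CompleteSpace K] [IsDiscreteValuationRing 𝒪[K]] [Finite 𝓀[K]]
    (hρρ : ∀ x, ρ (ρ x) = x) (hvρ : ∀ x, Valued.v (ρ x) = Valued.v x)
    (hΘΘ : ∀ x, Θ (Θ x) = x) (hΘρ : ∀ x, Θ (ρ x) = ρ (Θ x)) (hvΘ : ∀ x, Valued.v (Θ x) = Valued.v x)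
    (hΘres : ∀ x : K, Valued.v x ≤ 1 → Valued.v (x - Θ x) < 1)
    {ϖM : K} (hϖM : Valued.v ϖM = exp (-1 : ℤ)) {dρ dΘ t : ℕ}
    (hDρ : IsRamifiedQuadraticDatum ρ ϖM dρ t) (hDΘ : IsRamifiedQuadraticDatum Θ ϖM dΘ t)
    (hF4 : ∀ z : K, ρ z = z → Θ z = z → z ≠ 0 → ∃ n : ℤ, Valued.v z = exp (4 * n))
    (hFN : ∀ f : K, ρ f = f → Θ f = f → Valued.v f = 1 → ∃ z : K, z * Θ z = f)
    {ϖE : K} (hϖE : Valued.v ϖE = exp (-2 : ℤ)) (hρϖ : ρ ϖE = ϖE)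
    (hq : Nat.card 𝓀[K] = 2)
    {g s0 d' : ℕ} (hg2 : dΘ = 2 * g) (hg1 : 1 ≤ g) (hs01 : 1 ≤ s0)
    (hd'v : Valued.v (ϖM * Θ ϖM - ρ (ϖM * Θ ϖM)) = exp (-(2 * (d' : ℤ)))) (hds : 2 * d' = dρ + 2 * s0)
    {h : K} (hΘh : Θ h = h) (hh : h ≠ 0) (hhyper : ∃ x : K, x ≠ 0 ∧ h * Θ x * x + ρ (h * Θ x * x) = 0)
    {vh e : ℤ} (hvh : Valued.v h = exp (-vh)) (he : vh + dρ = 2 * e)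
    {j a : ℕ} (ha : 1 ≤ a) (hbdry : j + 2 = a + s0 + 2 * g) :
    levelSet ρ Θ ϖM ϖE h j a = ∅ := by
  refine levelSet_eq_empty_of_ncard_eq_zero hvρ hvΘ ?_
  rw [ncard_levelSet_boundary_ramM_hyper hρρ hvρ hΘΘ hΘρ hvΘ hΘres hϖM hDρ hDΘ hF4 hFN hϖE hρϖ hq (dvd_refl 2) hg2 hg1 hs01 hd'v hds hΘh hh hhyper hvh he
    ha hbdry]
  norm_num

/-- **RamM, `q = 2`: `levelSetDep(B; μ) = ∅` FOR EVERY MULTIPLIER `μ`.** [cite: Flicker1998UnitaryFL, Prop. 7 p. 84] [cite: Kottwitz1986BaseChangeUnits, §1 pp. 240–241] -/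
theorem levelSetDep_boundary_ramM_hyper_eq_empty_of_card [CompleteSpace K] [IsDiscreteValuationRing 𝒪[K]] [Finite 𝓀[K]]
    (hρρ : ∀ x, ρ (ρ x) = x) (hvρ : ∀ x, Valued.v (ρ x) = Valued.v x)
    (hΘΘ : ∀ x, Θ (Θ x) = x) (hΘρ : ∀ x, Θ (ρ x) = ρ (Θ x)) (hvΘ : ∀ x, Valued.v (Θ x) = Valued.v x)
    (hΘres : ∀ x : K, Valued.v x ≤ 1 → Valued.v (x - Θ x) < 1)
    {ϖM : K} (hϖM : Valued.v ϖM = exp (-1 : ℤ)) {dρ dΘ t : ℕ}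
    (hDρ : IsRamifiedQuadraticDatum ρ ϖM dρ t) (hDΘ : IsRamifiedQuadraticDatum Θ ϖM dΘ t)
    (hF4 : ∀ z : K, ρ z = z → Θ z = z → z ≠ 0 → ∃ n : ℤ, Valued.v z = exp (4 * n))
    (hFN : ∀ f : K, ρ f = f → Θ f = f → Valued.v f = 1 → ∃ z : K, z * Θ z = f)
    {ϖE : K} (hϖE : Valued.v ϖE = exp (-2 : ℤ)) (hρϖ : ρ ϖE = ϖE)
    (hq : Nat.card 𝓀[K] = 2)
    {g s0 d' : ℕ} (hg2 : dΘ = 2 * g) (hg1 : 1 ≤ g) (hs01 : 1 ≤ s0)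
    (hd'v : Valued.v (ϖM * Θ ϖM - ρ (ϖM * Θ ϖM)) = exp (-(2 * (d' : ℤ)))) (hds : 2 * d' = dρ + 2 * s0)
    {h : K} (hΘh : Θ h = h) (hh : h ≠ 0) (hhyper : ∃ x : K, x ≠ 0 ∧ h * Θ x * x + ρ (h * Θ x * x) = 0)
    {vh e : ℤ} (hvh : Valued.v h = exp (-vh)) (he : vh + dρ = 2 * e)
    {j a : ℕ} (ha : 1 ≤ a) (hbdry : j + 2 = a + s0 + 2 * g) (μ : K) :
    levelSetDep ρ Θ ϖM ϖE h j a μ = ∅ :=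
  levelSetDep_eq_empty_of_levelSet_eq_empty
    (levelSet_boundary_ramM_hyper_eq_empty_of_card hρρ hvρ hΘΘ hΘρ hvΘ hΘres hϖM hDρ hDΘ hF4 hFN hϖE hρϖ hq hg2 hg1 hs01 hd'v hds hΘh hh hhyper hvh he
      ha hbdry) μ

/-- **RamM, `q = 2`: THE `cellDiff` OF THE HYPERBOLIC BOUNDARY CELL VANISHES** (every `μ`, labels `P, Q`, weight `f`). [cite: Kottwitz1986BaseChangeUnits, §1 pp. 240–241] [cite: Flicker1998UnitaryFL, Prop. 7 p. 84] -/
theorem cellDiff_boundary_ramM_hyper_eq_zero_of_card [CompleteSpace K] [IsDiscreteValuationRing 𝒪[K]] [Finite 𝓀[K]]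
    (hρρ : ∀ x, ρ (ρ x) = x) (hvρ : ∀ x, Valued.v (ρ x) = Valued.v x)
    (hΘΘ : ∀ x, Θ (Θ x) = x) (hΘρ : ∀ x, Θ (ρ x) = ρ (Θ x)) (hvΘ : ∀ x, Valued.v (Θ x) = Valued.v x)
    (hΘres : ∀ x : K, Valued.v x ≤ 1 → Valued.v (x - Θ x) < 1)
    {ϖM : K} (hϖM : Valued.v ϖM = exp (-1 : ℤ)) {dρ dΘ t : ℕ}
    (hDρ : IsRamifiedQuadraticDatum ρ ϖM dρ t) (hDΘ : IsRamifiedQuadraticDatum Θ ϖM dΘ t)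
    (hF4 : ∀ z : K, ρ z = z → Θ z = z → z ≠ 0 → ∃ n : ℤ, Valued.v z = exp (4 * n))
    (hFN : ∀ f : K, ρ f = f → Θ f = f → Valued.v f = 1 → ∃ z : K, z * Θ z = f)
    {ϖE : K} (hϖE : Valued.v ϖE = exp (-2 : ℤ)) (hρϖ : ρ ϖE = ϖE)
    (hq : Nat.card 𝓀[K] = 2)
    {g s0 d' : ℕ} (hg2 : dΘ = 2 * g) (hg1 : 1 ≤ g) (hs01 : 1 ≤ s0)
    (hd'v : Valued.v (ϖM * Θ ϖM - ρ (ϖM * Θ ϖM)) = exp (-(2 * (d' : ℤ)))) (hds : 2 * d' = dρ + 2 * s0)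
    {h : K} (hΘh : Θ h = h) (hh : h ≠ 0) (hhyper : ∃ x : K, x ≠ 0 ∧ h * Θ x * x + ρ (h * Θ x * x) = 0)
    {vh e : ℤ} (hvh : Valued.v h = exp (-vh)) (he : vh + dρ = 2 * e)
    {j a : ℕ} (ha : 1 ≤ a) (hbdry : j + 2 = a + s0 + 2 * g) (μ : K)
    (P Q : AddSubgroup K → Prop) (f : AddSubgroup K → ℕ) :
    ((∑ᶠ Λ ∈ levelSetDep ρ Θ ϖM ϖE h j a μ ∩ {Λ | P Λ}, f Λ : ℕ) : ℤ) - ((∑ᶠ Λ ∈ levelSetDep ρ Θ ϖM ϖE h j a μ ∩ {Λ | Q Λ}, f Λ : ℕ) : ℤ) = 0 :=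
  finsum_inter_sub_finsum_inter_eq_zero_of_eq_empty _
    (levelSetDep_boundary_ramM_hyper_eq_empty_of_card hρρ hvρ hΘΘ hΘρ hvΘ hΘres hϖM hDρ hDΘ hF4 hFN hϖE hρϖ hq hg2 hg1 hs01 hd'v hds hΘh hh hhyper hvh he
      ha hbdry μ) P Q f

end RamM

end Summit.HodgeConjecture.HodgeConjecture.Cruxes.H413.F0P3cDyRamConeCellBoundaryEmptyAtTwo

end
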